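import Summits.Ventures.CertifiedManyBodySolver.Observables.StiffnessKinematicLeaf
import Literature.MathematicalPhysics.QuantumLattice.HubbardFermiSeaCellRows
import HarnessLib

/-!
# Ventures/CertifiedManyBodySolver — Observables/StiffnessKinematicLeafDensity.lean

HONEST FRAMING: one-sided CEILINGS on the uniform flux stiffness at the KINEMATIC (one-body) scale, now DENSITY-SPECIFIC and
RATIONAL at every `t′ = 0` anchor; a ceiling never speaks to the presence of order; not informative vs print; not a superconductivity
verdict. Zero compute, no definition, no claim node, no `sorry`.

Cell `hubbard-obs` (D-0042), seat p2 (stiffness), `prover-hubbard-obs-p2-g10-0`. The node-free kinematic leaf of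
`Observables/StiffnessKinematicLeaf.lean` (p2 g9) is the half-filled value `4/π² ≤ 0.4052848` at EVERY density (hubbard-fast's K₁ row); the
density-specific one-body bar `¼|e_free(n)|` (`0.4019425` at `n = 7/8`, `0.3957697` at `n = 4/5`) was quoted as a float-evaluated exact
constant. Meanwhile hubbard-fast LANDED kernel-checked Fermi-sea rows `ℓ(t′, n) ≤ e(1, t′, U, n)` (`Literature/…/HubbardFermiSeaCellRows.lean`,
cell-exact `M = 64` tables, within `1.5–2.6·10⁻³` of the exact bathtub value). This file turns the `t′ = 0` rows into stiffness leaves: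

* `torusLimit_negKinetic_le_of_freeEnergyFloor` — GENERIC: a certified floor `ℓ ≤ e(1, 0, 0, n)` on the FREE energy density at density `n`
  gives `−k(ω) ≤ −ℓ` for every torus limit `ω` of unit `(rectN n L, S^z = 0)`-sector ground states of `hubbardTorusTT' L 1 t′ U` (ANY `t′`, `U`;
  `k(ω) = e_{Φ(1,0,0)}(ω) ≥ e(1,0,0,n)` is the thermodynamic-limit variational inequality
  `IsTorusLimitOf.energyDensityTT'_le_meanEnergy_hubbardTTPrime` at the coupling `(1, 0, 0)` — each `ψ_L` is a trial state of the free problem);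
* `ObsStiffnessSeqCeilingAt_tp0_of_freeEnergyFloor` — hence the robust leaf `ObsStiffnessSeqCeilingAt 0 U n c` for every `c ≥ −ℓ/4`
  (`t′ = 0`, any `U`; `Observables.ObsStiffnessSeqCeilingAt_tp0_of_kineticDensity_ge`);
* INSTANCES, no premise: `n = 7/8` (anchors A1/A6/A7/A8 = (8|6|4|10, 7/8, 0)): `−k ≤ 1.6103642235`, leaf constant
  `3220728447/8000000000 = 0.4025910559` (was `0.4052848`; exact one-body value `0.4019425`); `n = 4/5` (A4 = (8, 4/5, 0)): `−k ≤ 1.5855953908`,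
  leaf `3963988477/10000000000 = 0.3963988477` (was `0.4052848`; exact `0.3957697`). At `n = 1` the cell row (`1.6228764`) is WEAKER than the exact
  `16/π² < 1.6211390` already typed, so nothing is added there. `M3ObsStiffnessCeilingAt_tp0 (3220728447/8000000000)` holds with NO premise.
* Literals: the certified leaves of record at `(8, 7/8, 0)` (chord `0.3748013`, kinlo `0.3359318`) lie below `0.4025911`; `0.4025910559 − 0.4019425 < 7·10⁻⁴`.

* §5 (append): `torusLimit_totalHopping_le_of_freeEnergyFloor` — the TOTAL hopping energy `U·D − e₀ = −(K₁ + t′K₂)` at any `(U, n, t′)` is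
  `≤ |ℓ|` for a free-energy floor `ℓ ≤ e(1, t′, 0, n)` at the SAME `t′` (not the stiffness functional, which doubles `t′`); A0 instance
  `m3_tpm1o4_totalHopping_le_kinematic` (`≤ 1.5633689`, below registry row 3's derived `1.6032982`).

What this buys: the «informative vs kinematics» test of every `t′ = 0` stiffness / kinetic edge of the burst table is now a KERNEL inequality
against the density-specific bar (to `7·10⁻⁴`), not a float comparison. The `t′ ≠ 0` anchors still use the real-valued half-bathtub bar of
`Observables/StiffnessKinematicLeafTTPrime.lean` (their rational bar needs a Fermi-sea row at `t″ = 2t′`, e.g. `t″ = −1/2` for A0/A2/A10, which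
`HubbardFermiSeaCellRows` does not carry, and the `D₄`-orbit dictionary of the `t–t′` kinetic word — not done here).

References: E. H. Lieb, M. Loss, Duke Math. J. 71 (1993) 337, §8 Thm 8.2 [LiebLoss1993]; D. Ruelle, *Statistical Mechanics* (1969) §3.4
[Ruelle1969]; D. J. Scalapino, S. R. White, S.-C. Zhang, PRB 47 (1993) 7995, §II [ScalapinoWhiteZhang1993].
-/

noncomputable section

namespace Summit.Ventures.CertifiedManyBodySolver.Observables

open Literature.MathematicalPhysics.QuantumLattice
open Literature.MathematicalPhysics.QuantumLattice.ThermodynamicLimit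
open Literature.Probability.LatticeModels
open Matrix Finset Filter Topology HubbardWave0
open scoped Matrix BigOperators ComplexOrder

/-! ## §1 Generic: a free-energy floor at density `n` is a kinetic ceiling on every torus-limit ground-state class of that density -/

/-- **Kinetic CEILING from a FREE-energy floor.** `0 ≤ n < 2`, any `t′`, `U`; if `ℓ ≤ e(1, 0, 0, n)` then for every torus limit `ω` of unit
`(rectN n L, S^z = 0)`-sector ground states of `hubbardTorusTT' L 1 t′ U`: `−k(ω) ≤ −ℓ` (bond form; the nearest-neighbour kinetic energy per site).
Proof: `k(ω) = e_{Φ(1,0,0)}(ω)` (`meanEnergy_hubbardTTPrime_oneBody_eq_kineticDensity`) and `e(1,0,0,n) ≤ e_{Φ(1,0,0)}(ω)`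
(`IsTorusLimitOf.energyDensityTT'_le_meanEnergy_hubbardTTPrime`: the `ψ_L` are unit `rectN n`-vectors, trial states of the free torus problem).
[cite: Ruelle1969, §3.4] [cite: LiebLoss1993, §8, Theorem 8.2] -/
theorem torusLimit_negKinetic_le_of_freeEnergyFloor {tp U n : ℝ} (hn0 : 0 ≤ n) (hn2 : n < 2) {ℓ : ℝ}
    (hℓ : ℓ ≤ energyDensityTT' 1 0 0 n) :
    ∀ (ω : InfVolFermionState 2) (Ls : ℕ → ℕ) (ψ : ∀ L, Fock (Orb (FermionTorus 2 L))),
      Tendsto Ls atTop atTop →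
      (∀ j, IsGroundStateInSector (hubbardTorusTT' (Ls j) 1 tp U) (rectN n (Ls j)) 0 (ψ (Ls j))) →
      (∀ j, star (ψ (Ls j)) ⬝ᵥ ψ (Ls j) = 1) → ω.IsTorusLimitOf ψ Ls →
      -(∑ i : Fin 2, -(1 : ℝ) * ∑ σ : Fin 2,
          ((ω.expect {0, 0 + unitVec i}
              ((cAt 0 (mem_insert_self _ _) σ)ᴴ * cAt (0 + unitVec i) (mem_insert_of_mem (mem_singleton_self _)) σ)).re +
            (ω.expect {0, 0 + unitVec i}
              ((cAt (0 + unitVec i) (mem_insert_of_mem (mem_singleton_self _)) σ)ᴴ * cAt 0 (mem_insert_self _ _) σ)).re)) ≤ -ℓ := by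
  intro ω Ls ψ hLs hψ h1 hω
  have hN : ∀ j, IsNParticle (rectN n (Ls j)) (ψ (Ls j)) := fun j => ((mem_szSector_iff _ _ _).1 (hψ j).1).1
  have h := hω.energyDensityTT'_le_meanEnergy_hubbardTTPrime 1 0 (U := 0) le_rfl hn0 hn2 hLs hN h1
  rw [meanEnergy_hubbardTTPrime_oneBody_eq_kineticDensity hω.isTranslationInvariant] at h
  linarith

/-- **CLASS-UNIFORM kinetic window from a free-energy floor and a cap** (`t′ = 0`, `U ≥ 0`, `0 ≤ n < 2`): `ℓ ≤ e(1,0,0,n)` and `e₀(U,n,0) ≤ hi`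
give `−hi ≤ −k(ω) ≤ −ℓ` on the whole torus-limit ground-state class at `(U, n, 0)` — the a-priori kinetic window of an anchor before any
observable solve. [cite: LiebLoss1993, §8, Theorem 8.2] -/
theorem torusLimit_negKinetic_apriori_of_freeEnergyFloor_of_cap {U n : ℝ} (hU : 0 ≤ U) (hn0 : 0 ≤ n) (hn2 : n < 2) {ℓ : ℝ}
    (hℓ : ℓ ≤ energyDensityTT' 1 0 0 n) {hi : ℚ} (hcap : energyDensityTT' 1 0 U n ≤ ((hi : ℚ) : ℝ)) :
    ∀ (ω : InfVolFermionState 2) (Ls : ℕ → ℕ) (ψ : ∀ L, Fock (Orb (FermionTorus 2 L))),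
      Tendsto Ls atTop atTop →
      (∀ j, IsGroundStateInSector (hubbardTorusTT' (Ls j) 1 0 U) (rectN n (Ls j)) 0 (ψ (Ls j))) →
      (∀ j, star (ψ (Ls j)) ⬝ᵥ ψ (Ls j) = 1) → ω.IsTorusLimitOf ψ Ls →
      -((hi : ℚ) : ℝ) ≤ -(∑ i : Fin 2, -(1 : ℝ) * ∑ σ : Fin 2,
          ((ω.expect {0, 0 + unitVec i}
              ((cAt 0 (mem_insert_self _ _) σ)ᴴ * cAt (0 + unitVec i) (mem_insert_of_mem (mem_singleton_self _)) σ)).re +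
            (ω.expect {0, 0 + unitVec i}
              ((cAt (0 + unitVec i) (mem_insert_of_mem (mem_singleton_self _)) σ)ᴴ * cAt 0 (mem_insert_self _ _) σ)).re)) ∧
      -(∑ i : Fin 2, -(1 : ℝ) * ∑ σ : Fin 2,
          ((ω.expect {0, 0 + unitVec i}
              ((cAt 0 (mem_insert_self _ _) σ)ᴴ * cAt (0 + unitVec i) (mem_insert_of_mem (mem_singleton_self _)) σ)).re +
            (ω.expect {0, 0 + unitVec i}
              ((cAt (0 + unitVec i) (mem_insert_of_mem (mem_singleton_self _)) σ)ᴴ * cAt 0 (mem_insert_self _ _) σ)).re)) ≤ -ℓ :=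
  fun ω Ls ψ hLs hψ h1 hω =>
    ⟨torusLimit_neg_cap_le_negKinetic hU hn0 hn2 hcap ω Ls ψ hLs hψ h1 hω,
      torusLimit_negKinetic_le_of_freeEnergyFloor hn0 hn2 hℓ ω Ls ψ hLs hψ h1 hω⟩

/-- **THE DENSITY-SPECIFIC KINEMATIC STIFFNESS LEAF** (`t′ = 0`, any `U`, `0 ≤ n < 2`): a certified free-energy floor `ℓ ≤ e(1,0,0,n)`
gives `ObsStiffnessSeqCeilingAt 0 U n c` for every rational `c ≥ −ℓ/4` — every flux stiffness `ρ_s > 0` whose flux inequality holds along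
some sequence of sides satisfies `ρ_s ≤ −ℓ/4` (tree units; HVR `−ℓ/8`; SWZ `−ℓ/2`). No certificate on the interacting problem, no claim node.
[cite: ScalapinoWhiteZhang1993, §II] [cite: LiebLoss1993, §8, Theorem 8.2] -/
theorem ObsStiffnessSeqCeilingAt_tp0_of_freeEnergyFloor {U n : ℝ} (hn0 : 0 ≤ n) (hn2 : n < 2) {ℓ : ℝ}
    (hℓ : ℓ ≤ energyDensityTT' 1 0 0 n) (c : ℚ) (hc : -ℓ / 4 ≤ ((c : ℚ) : ℝ)) :
    ObsStiffnessSeqCeilingAt 0 U n c := by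
  refine ObsStiffnessSeqCeilingAt_tp0_of_kineticDensity_ge hn2.le ℓ c hc fun ω Ls ψ hLs hψ h1 hω => ?_
  have h := torusLimit_negKinetic_le_of_freeEnergyFloor (tp := 0) (U := U) hn0 hn2 hℓ ω Ls ψ hLs hψ h1 hω
  linarith

/-- The all-even-sides form. [cite: ScalapinoWhiteZhang1993, §II] -/
theorem ObsStiffnessCeilingAt_tp0_of_freeEnergyFloor {U n : ℝ} (hn0 : 0 ≤ n) (hn2 : n < 2) {ℓ : ℝ}
    (hℓ : ℓ ≤ energyDensityTT' 1 0 0 n) (c : ℚ) (hc : -ℓ / 4 ≤ ((c : ℚ) : ℝ)) :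
    ObsStiffnessCeilingAt 0 U n c :=
  (ObsStiffnessSeqCeilingAt_tp0_of_freeEnergyFloor hn0 hn2 hℓ c hc).ceilingAt

/-! ## §2 Density `n = 7/8` (anchors A1/A6/A7/A8 of the burst table: `(8|6|4|10, 7/8, 0)`) -/

/-- **Kinematic kinetic ceiling at density `7/8`, NO premise**: for every torus limit `ω` of unit `(rectN (7/8) L, S^z = 0)`-sector ground
states of `hubbardTorusTT' L 1 t′ U` (any `t′`, `U`): `−k(ω) ≤ 1.6103642235` (hubbard-fast `fermiSeaCellRow_tPrime_zero_density_seven_div_eight`;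
exact one-body value `1.6077701`, the half-filled bar is `16/π² ≈ 1.6211389`). [cite: LiebLoss1993, §8, Theorem 8.2] -/
theorem torusLimit_negKinetic_le_density_seven_div_eight {tp U : ℝ} :
    ∀ (ω : InfVolFermionState 2) (Ls : ℕ → ℕ) (ψ : ∀ L, Fock (Orb (FermionTorus 2 L))),
      Tendsto Ls atTop atTop →
      (∀ j, IsGroundStateInSector (hubbardTorusTT' (Ls j) 1 tp U) (rectN (7 / 8) (Ls j)) 0 (ψ (Ls j))) →
      (∀ j, star (ψ (Ls j)) ⬝ᵥ ψ (Ls j) = 1) → ω.IsTorusLimitOf ψ Ls →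
      -(∑ i : Fin 2, -(1 : ℝ) * ∑ σ : Fin 2,
          ((ω.expect {0, 0 + unitVec i}
              ((cAt 0 (mem_insert_self _ _) σ)ᴴ * cAt (0 + unitVec i) (mem_insert_of_mem (mem_singleton_self _)) σ)).re +
            (ω.expect {0, 0 + unitVec i}
              ((cAt (0 + unitVec i) (mem_insert_of_mem (mem_singleton_self _)) σ)ᴴ * cAt 0 (mem_insert_self _ _) σ)).re)) ≤
        (1.6103642235 : ℝ) := by
  intro ω Ls ψ hLs hψ h1 hω
  have hℓ : (-1.6103642235 : ℝ) ≤ energyDensityTT' 1 0 0 (7 / 8) :=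
    fermiSeaCellRow_tPrime_zero_density_seven_div_eight (U := 0) le_rfl
  have h := torusLimit_negKinetic_le_of_freeEnergyFloor (tp := tp) (U := U) (n := 7 / 8) (by norm_num) (by norm_num) hℓ
    ω Ls ψ hLs hψ h1 hω
  linarith

/-- **Density-`7/8` kinematic stiffness leaf, NO premise**: `ObsStiffnessSeqCeilingAt 0 U (7/8) (3220728447/8000000000)` at every `U`
(`3220728447/8000000000 = 1.6103642235/4 = 0.4025910559`; the generic half-filled leaf was `0.4052848`, the exact one-body value is `0.4019425`).
[cite: ScalapinoWhiteZhang1993, §II] -/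
theorem ObsStiffnessSeqCeilingAt_tp0_density_seven_div_eight (U : ℝ) :
    ObsStiffnessSeqCeilingAt 0 U (7 / 8) (3220728447 / 8000000000) :=
  ObsStiffnessSeqCeilingAt_tp0_of_freeEnergyFloor (n := 7 / 8) (by norm_num) (by norm_num)
    (fermiSeaCellRow_tPrime_zero_density_seven_div_eight (U := 0) le_rfl) _ (by norm_num)

/-- The all-even-sides form at density `7/8`, no premise. -/
theorem ObsStiffnessCeilingAt_tp0_density_seven_div_eight (U : ℝ) :
    ObsStiffnessCeilingAt 0 U (7 / 8) (3220728447 / 8000000000) :=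
  (ObsStiffnessSeqCeilingAt_tp0_density_seven_div_eight U).ceilingAt

/-- **At `(8, 7/8, 0)`, NO premise**: `M3ObsStiffnessCeilingAt_tp0 (3220728447/8000000000)` (`0.4025910559`) — the registry's `t′ = 0` leaf shape at
the density-specific kinematic constant; the certified leaves of record (chord `0.3748013`, kinlo `0.3359318`) lie strictly below it.
[cite: ScalapinoWhiteZhang1993, §II] -/
theorem M3ObsStiffnessCeilingAt_tp0_density_seven_div_eight : M3ObsStiffnessCeilingAt_tp0 (3220728447 / 8000000000) :=
  (ObsStiffnessSeqCeilingAt_tp0_density_seven_div_eight 8).m3_tp0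

/-! ## §3 Density `n = 4/5` (anchor A4 = (8, 4/5, 0)) -/

/-- **Kinematic kinetic ceiling at density `4/5`, NO premise**: `−k(ω) ≤ 1.5855953908` on every torus-limit ground-state class of density `4/5`
(any `t′`, `U`; hubbard-fast `fermiSeaCellRow_tPrime_zero_density_four_div_five`; exact one-body value `1.5830788`). [cite: LiebLoss1993, §8, Theorem 8.2] -/
theorem torusLimit_negKinetic_le_density_four_div_five {tp U : ℝ} :
    ∀ (ω : InfVolFermionState 2) (Ls : ℕ → ℕ) (ψ : ∀ L, Fock (Orb (FermionTorus 2 L))),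
      Tendsto Ls atTop atTop →
      (∀ j, IsGroundStateInSector (hubbardTorusTT' (Ls j) 1 tp U) (rectN (4 / 5) (Ls j)) 0 (ψ (Ls j))) →
      (∀ j, star (ψ (Ls j)) ⬝ᵥ ψ (Ls j) = 1) → ω.IsTorusLimitOf ψ Ls →
      -(∑ i : Fin 2, -(1 : ℝ) * ∑ σ : Fin 2,
          ((ω.expect {0, 0 + unitVec i}
              ((cAt 0 (mem_insert_self _ _) σ)ᴴ * cAt (0 + unitVec i) (mem_insert_of_mem (mem_singleton_self _)) σ)).re +
            (ω.expect {0, 0 + unitVec i}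
              ((cAt (0 + unitVec i) (mem_insert_of_mem (mem_singleton_self _)) σ)ᴴ * cAt 0 (mem_insert_self _ _) σ)).re)) ≤
        (1.5855953908 : ℝ) := by
  intro ω Ls ψ hLs hψ h1 hω
  have hℓ : (-1.5855953908 : ℝ) ≤ energyDensityTT' 1 0 0 (4 / 5) :=
    fermiSeaCellRow_tPrime_zero_density_four_div_five (U := 0) le_rfl
  have h := torusLimit_negKinetic_le_of_freeEnergyFloor (tp := tp) (U := U) (n := 4 / 5) (by norm_num) (by norm_num) hℓ
    ω Ls ψ hLs hψ h1 hω
  linarith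

/-- **Density-`4/5` kinematic stiffness leaf, NO premise**: `ObsStiffnessSeqCeilingAt 0 U (4/5) (3963988477/10000000000)` at every `U`
(`= 1.5855953908/4 = 0.3963988477`; generic half-filled leaf `0.4052848`; exact one-body value `0.3957697`). [cite: ScalapinoWhiteZhang1993, §II] -/
theorem ObsStiffnessSeqCeilingAt_tp0_density_four_div_five (U : ℝ) :
    ObsStiffnessSeqCeilingAt 0 U (4 / 5) (3963988477 / 10000000000) :=
  ObsStiffnessSeqCeilingAt_tp0_of_freeEnergyFloor (n := 4 / 5) (by norm_num) (by norm_num)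
    (fermiSeaCellRow_tPrime_zero_density_four_div_five (U := 0) le_rfl) _ (by norm_num)

/-- The all-even-sides form at density `4/5`, no premise. -/
theorem ObsStiffnessCeilingAt_tp0_density_four_div_five (U : ℝ) :
    ObsStiffnessCeilingAt 0 U (4 / 5) (3963988477 / 10000000000) :=
  (ObsStiffnessSeqCeilingAt_tp0_density_four_div_five U).ceilingAt

/-! ## §4 Literals -/

/-- Literals (decidable): the density-specific leaf constants `0.4025910559` (`n = 7/8`) and `0.3963988477` (`n = 4/5`) are below the generic
half-filled `0.4052848`; the certified leaves of record at `(8, 7/8, 0)` (chord `906213886029816052260099/2⁸¹ ≈ 0.3748013`, kinlo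
`223264916321536523710802363374151687/2¹¹⁹ ≈ 0.3359318`) are below `0.4025910559`; both constants are within `7·10⁻⁴` of the float-evaluated exact
one-body values `0.4019425` / `0.3957697` (quoted, not asserted as bounds); and at `n = 1` the Fermi-sea cell row `1.6228764206/4` does NOT beat
`0.4052848` (so the `16/π²` leaf stays the `n = 1` bar). -/
theorem stiffnessKinematicLeafDensity_literals :
    ((3220728447 / 8000000000 : ℚ) < 4052848 / 10000000) ∧
      ((3963988477 / 10000000000 : ℚ) < 4052848 / 10000000) ∧
      ((906213886029816052260099 / 2417851639229258349412352 : ℚ) < 3220728447 / 8000000000) ∧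
      ((223264916321536523710802363374151687 / 664613997892457936451903530140172288 : ℚ) < 3220728447 / 8000000000) ∧
      ((3220728447 / 8000000000 : ℚ) - 4019425 / 10000000 < 7 / 10000) ∧
      ((3963988477 / 10000000000 : ℚ) - 3957697 / 10000000 < 7 / 10000) ∧
      ((4052848 / 10000000 : ℚ) < 16228764206 / 40000000000) := by
  norm_num

/-! ## §5 Density `n = 3/4` (atlas-pilot anchor `(8, 3/4, 0)` of the Hubbard re-charter, cell of record [#413, #450];
appended 2026-08-26 by hubbard-obs-menu-1 on hubbard-fast's `fermiSeaCellRow_tPrime_zero_density_three_div_four`) -/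

/-- **Kinematic kinetic ceiling at density `3/4`, NO premise**: `−k(ω) ≤ 1.5605611532` on every torus-limit ground-state class of density `3/4`
(any `t′`, `U`; hubbard-fast `fermiSeaCellRow_tPrime_zero_density_three_div_four`; float one-body value `1.5582567`, the half-filled bar is
`16/π² ≈ 1.6211389`). [cite: LiebLoss1993, §8, Theorem 8.2] -/
theorem torusLimit_negKinetic_le_density_three_div_four {tp U : ℝ} :
    ∀ (ω : InfVolFermionState 2) (Ls : ℕ → ℕ) (ψ : ∀ L, Fock (Orb (FermionTorus 2 L))),
      Tendsto Ls atTop atTop →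
      (∀ j, IsGroundStateInSector (hubbardTorusTT' (Ls j) 1 tp U) (rectN (3 / 4) (Ls j)) 0 (ψ (Ls j))) →
      (∀ j, star (ψ (Ls j)) ⬝ᵥ ψ (Ls j) = 1) → ω.IsTorusLimitOf ψ Ls →
      -(∑ i : Fin 2, -(1 : ℝ) * ∑ σ : Fin 2,
          ((ω.expect {0, 0 + unitVec i}
              ((cAt 0 (mem_insert_self _ _) σ)ᴴ * cAt (0 + unitVec i) (mem_insert_of_mem (mem_singleton_self _)) σ)).re +
            (ω.expect {0, 0 + unitVec i}
              ((cAt (0 + unitVec i) (mem_insert_of_mem (mem_singleton_self _)) σ)ᴴ * cAt 0 (mem_insert_self _ _) σ)).re)) ≤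
        (1.5605611532 : ℝ) := by
  intro ω Ls ψ hLs hψ h1 hω
  have hℓ : (-1.5605611532 : ℝ) ≤ energyDensityTT' 1 0 0 (3 / 4) :=
    fermiSeaCellRow_tPrime_zero_density_three_div_four (U := 0) le_rfl
  have h := torusLimit_negKinetic_le_of_freeEnergyFloor (tp := tp) (U := U) (n := 3 / 4) (by norm_num) (by norm_num) hℓ
    ω Ls ψ hLs hψ h1 hω
  linarith

/-- **Density-`3/4` kinematic stiffness leaf, NO premise**: `ObsStiffnessSeqCeilingAt 0 U (3/4) (3901402883/10000000000)` at every `U`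
(`= 1.5605611532/4 = 0.3901402883`; generic half-filled leaf `0.4052848`; float one-body value `0.3895642`). [cite: ScalapinoWhiteZhang1993, §II] -/
theorem ObsStiffnessSeqCeilingAt_tp0_density_three_div_four (U : ℝ) :
    ObsStiffnessSeqCeilingAt 0 U (3 / 4) (3901402883 / 10000000000) :=
  ObsStiffnessSeqCeilingAt_tp0_of_freeEnergyFloor (n := 3 / 4) (by norm_num) (by norm_num)
    (fermiSeaCellRow_tPrime_zero_density_three_div_four (U := 0) le_rfl) _ (by norm_num)

/-- The all-even-sides form at density `3/4`, no premise. -/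
theorem ObsStiffnessCeilingAt_tp0_density_three_div_four (U : ℝ) :
    ObsStiffnessCeilingAt 0 U (3 / 4) (3901402883 / 10000000000) :=
  (ObsStiffnessSeqCeilingAt_tp0_density_three_div_four U).ceilingAt

/-- Literals for the density-`3/4` leaf (decidable): the constant `0.3901402883` is below the generic half-filled `0.4052848` and below the
`n = 4/5` and `n = 7/8` constants (the kinematic bar decreases with doping), lies within `6·10⁻⁴` of the float one-body value `0.3895642`
(quoted, not asserted as a bound), and the cap-only a-priori kinetic floor at `(8, 3/4, 0)`, `−hi(#450) = 61045175247669/2⁴⁶ ≈ 0.8675041`,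
is below the kinematic ceiling `1.5605611532` (so the kinetic cell `[0.8675041, −k^up]` is non-empty for any certified `−k^up` in between). -/
theorem stiffnessKinematicLeafDensity34_literals :
    ((3901402883 / 10000000000 : ℚ) < 4052848 / 10000000) ∧
      ((3901402883 / 10000000000 : ℚ) < 3963988477 / 10000000000) ∧
      ((3963988477 / 10000000000 : ℚ) < 3220728447 / 8000000000) ∧
      ((3901402883 / 10000000000 : ℚ) - 3895642 / 10000000 < 6 / 10000) ∧
      ((61045175247669 / 70368744177664 : ℚ) < 3901402883 / 2500000000) := by
  norm_num

/-! ## §5 (append, p2 g10) The TOTAL hopping energy at any `t′`: kinematic ceiling from a free-energy floor at the SAME `t′` -/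

/-- **Kinematic ceiling on the TOTAL hopping energy at `(U, n, t′)`** (`U ≥ 0`, `0 ≤ n < 2`, any `t′`): a certified floor `ℓ ≤ e(1, t′, 0, n)` on the
free `t–t′` energy (e.g. a hubbard-fast `fermiSea[Cell]Row_tPrime_<t′>_density_<n>`) gives, for every torus limit `ω` of unit
`(rectN n L, S^z = 0)`-sector ground states of `hubbardTorusTT' L 1 t′ U`: `U·Re ω(n↑n↓) − e(1,t′,U,n) ≤ −ℓ` — i.e. the total (nearest-neighbour +
`t′`·diagonal) hopping energy magnitude `−(K₁ + t′K₂)(ω) = U·D(ω) − e₀` is at most `|ℓ|` (`e_{Φ(1,t′,0)}(ω) = e_{Φ(1,t′,U)}(ω) − U·D(ω)`,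
`meanEnergy_hubbardTTPrime_affine`; variational inequality at the free coupling). NOT the stiffness functional at `t′ ≠ 0` (that one doubles `t′`,
`Observables/StiffnessTLKineticTTOrbitDictionary.lean`); it is the quantity of registry rows 3 / 27 (`OBS.hop.tpm1o4.*`). [cite: LiebLoss1993, §8, Theorem 8.2] -/
theorem torusLimit_totalHopping_le_of_freeEnergyFloor (tp : ℝ) {U n : ℝ} (hU : 0 ≤ U) (hn0 : 0 ≤ n) (hn2 : n < 2) {ℓ : ℝ}
    (hℓ : ℓ ≤ energyDensityTT' 1 tp 0 n) :
    ∀ (ω : InfVolFermionState 2) (Ls : ℕ → ℕ) (ψ : ∀ L, Fock (Orb (FermionTorus 2 L))),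
      Tendsto Ls atTop atTop →
      (∀ j, IsGroundStateInSector (hubbardTorusTT' (Ls j) 1 tp U) (rectN n (Ls j)) 0 (ψ (Ls j))) →
      (∀ j, star (ψ (Ls j)) ⬝ᵥ ψ (Ls j) = 1) → ω.IsTorusLimitOf ψ Ls →
      U * (ω.expect ({0} : Finset (Site 2))
          (nAt 0 (Finset.mem_singleton_self 0) 0 * nAt 0 (Finset.mem_singleton_self 0) 1)).re - energyDensityTT' 1 tp U n ≤ -ℓ := by
  intro ω Ls ψ hLs hψ h1 hω
  have hN : ∀ j, IsNParticle (rectN n (Ls j)) (ψ (Ls j)) := fun j => ((mem_szSector_iff _ _ _).1 (hψ j).1).1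
  have hvar := hω.energyDensityTT'_le_meanEnergy_hubbardTTPrime 1 tp (U := 0) le_rfl hn0 hn2 hLs hN h1
  have he := hω.meanEnergy_hubbardTTPrime_eq_energyDensityTT' 1 tp hU hn0 hn2 hLs hψ h1
  have haff := ω.meanEnergy_hubbardTTPrime_affine 1 tp 0 tp U
  rw [sub_self, zero_mul, add_zero, sub_zero, hω.meanEnergy_onSite_eq_re_expect_docc hLs] at haff
  linarith

/-- **A0 = (8, 7/8, −¼) instance, NO premise**: the total hopping energy magnitude of every torus-limit ground state at (8, 7/8, −¼) satisfies
`8·Re ω(n↑n↓) − e₀(8, 7/8, −¼) ≤ 1.5633688449` (hubbard-fast `fermiSeaCellRow_tPrime_neg_one_div_four_density_seven_div_eight`) — BELOW registry row 3's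
certified docc-route ceiling `OBS.hop.tpm1o4.TLderived` = 969134271254592452252095/2⁷⁹ = 1.6032982 (the one-body bound is the sharper ceiling there; row 27's
FLOOR 0.7502603 makes the A0 total-hopping window `[0.7502603, 1.5633689]`). [cite: LiebLoss1993, §8, Theorem 8.2] -/
theorem m3_tpm1o4_totalHopping_le_kinematic :
    ∀ (ω : InfVolFermionState 2) (Ls : ℕ → ℕ) (ψ : ∀ L, Fock (Orb (FermionTorus 2 L))),
      Tendsto Ls atTop atTop →
      (∀ j, IsGroundStateInSector (hubbardTorusTT' (Ls j) 1 (-1 / 4) 8) (rectN (7 / 8) (Ls j)) 0 (ψ (Ls j))) →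
      (∀ j, star (ψ (Ls j)) ⬝ᵥ ψ (Ls j) = 1) → ω.IsTorusLimitOf ψ Ls →
      8 * (ω.expect ({0} : Finset (Site 2))
          (nAt 0 (Finset.mem_singleton_self 0) 0 * nAt 0 (Finset.mem_singleton_self 0) 1)).re - energyDensityTT' 1 (-1 / 4) 8 (7 / 8) ≤
        (1.5633688449 : ℝ) := by
  intro ω Ls ψ hLs hψ h1 hω
  have hℓ : (-1.5633688449 : ℝ) ≤ energyDensityTT' 1 (-1 / 4) 0 (7 / 8) :=
    fermiSeaCellRow_tPrime_neg_one_div_four_density_seven_div_eight (U := 0) le_rfl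
  have h := torusLimit_totalHopping_le_of_freeEnergyFloor (-1 / 4) (U := 8) (n := 7 / 8) (by norm_num) (by norm_num) (by norm_num) hℓ
    ω Ls ψ hLs hψ h1 hω
  linarith

/-- Literal (decidable): the kinematic total-hopping ceiling at A0, `1.5633688449`, is below registry row 3's derived ceiling
`969134271254592452252095/2⁷⁹ ≈ 1.6032982` (by `0.0399293`), and above row 27's floor `453504579244274003115851/2⁷⁹ ≈ 0.7502604`. -/
theorem m3_tpm1o4_totalHopping_kinematic_literals :
    ((15633688449 / 10000000000 : ℚ) < 969134271254592452252095 / 604462909807314587353088) ∧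
      ((453504579244274003115851 / 604462909807314587353088 : ℚ) < 15633688449 / 10000000000) := by
  norm_num

end Summit.Ventures.CertifiedManyBodySolver.Observables

end
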